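import Mathlib
import HarnessLib
import HarnessLib.Audit
import Summits.CriticalPhenomena.Statement
import Literature.Probability.LatticeModels.RandomCurrents
import Literature.Probability.LatticeModels.LatticeGreenFunction
import Literature.Probability.LatticeModels.EffectiveResistance
import HarnessLib.Audit.Status.Attr

/-!
Route: MeanCurrentCircleLaw

DORMANT since 2026-08-29T19:35:13Z (census g0: costume|duplicate of —; reader census-reader-38-g0) — unstaffed, not closed; items shared with open routes are served there. `ledger route dormant <id> --off` reactivates.

# Route MeanCurrentCircleLaw — Kirchhoff meets Moebius — the mean critical current from x to y
(Kirchhoff flow of the odd-current graph) is the parameter-free bipolar (circle) field;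
current-sector target with imported spin complements

It suffices to show X = CircleLaw ∧ HalfFluxLaw ∧ MeanCurrentExists ∧ MoebiusLimitExists ∧
NonGaussianEveryLimit, realising idea card
mean-current-circle-law (spine, sole card). OBJECT (rev 2, cone repair 2026-08-15: the
ranking-averaged Aizenman exploration backbone of
rev 1 is replaced by its rule-free harmonic representative, so that the route file imports only the
fully proved modules RandomCurrents +
LatticeGreenFunction + EffectiveResistance): for the critical sourced random current n on the torus
(ℤ/(N+1)ℤ)³ at β = β_c(3) (sources the projections of
x, y ∈ ℤ³; law ∝ 1{∂n = {x,y}} w_β(n)) let η(n) = {e : n_e odd} be its odd-bond (high-temperature)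
graph — x and y are its only odd
vertices, hence joined in it — and let θ_n be the unit KIRCHHOFF (electrical) flow from x to y in
η(n) with unit conductances, written
choice-free through the library's effective resistances (EffectiveResistance.lean, Dirichlet
principle, Mathlib-only imports):
θ_n(v,w) = 1_η(vw)·[(R_n(v,y) − R_n(v,x)) − (R_n(w,y) − R_n(w,x))]/2, R_n(v,w) =
(effectiveResistance torus 1_η {v} {w}).toReal
(0 on the diagonal, ⊤ ↦ 0 off the component; the potential of the unit flow is φ_z = (R_xy + R_zy −
R_zx)/2, Tetali1991; by Kirchhoff's theorem θ_n is the uniform-spanning-tree average of the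
tree-path currents of
η(n), i.e. the canonical average over backbone choices, LyonsPeres2016 §4.2; on a trivalent planar
lattice it is literally the
indicator current of the defect path of the O(1) loop representation). J_N(x,y;u,i) := E_N[θ_n(u,
u+e_i)] is the MEAN SIGNED CURRENT
through the oriented bond (u, u+e_i); J := lim_N J_N.
(MeanCurrentExists, r4) this infinite-volume limit exists. (CircleLaw, r2 — the card's crux F3)
tested against smooth compactly supported
vector fields off {x,y}, the mesh-δ current Σ_u Σ_i δ φ_i(δu) J([x/δ],[y/δ];u,i) converges as δ→0⁺
to ∫⟨B^{xy},φ⟩ with the BIPOLAR (circle)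
FIELD B^{xy}(z) = (|x−y|/(4π|z−x||z−y|))·((z−x)/|z−x|² − (z−y)/|z−y|²) = the normalised Wronskian
(G⁰_x∇G⁰_y − G⁰_y∇G⁰_x)/G⁰(x,y) of Newtonian
potentials: field lines = circles through x and y, |B| = |x−y|²/(4π r_x² r_y²), no exponent, no
amplitude, no free function.
(HalfFluxLaw, r3 — cheapest sharp instance) the mean signed flux through the equatorial disc of the
sphere with diameter [x,y] tends to
exactly 1/2 (lattice form: sources (0,0,−m), (0,0,m+1), bonds ((u₀,u₁,0),(u₀,u₁,1)) with 4(u₀²+u₁²)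
≤ (2m+1)², m → ∞).
(MoebiusLimitExists, r5) and (NonGaussianEveryLimit, r6) are the IMPORTED COMPLEMENTS — verbatim the
shared items stmt-CriticalPhenomena-1344
(conjunct minus clause (iii)) and stmt-CriticalPhenomena-0636 (every non-degenerate pointwise limit
has U₄ ≢ 0). DECLARED SCOPE: the
current-sector cruxes r2–r4 do not shorten the spin conjunct (the mean flux is parameter-free and
carries no Δ; spin n-point limits do
not determine the current's flow); the assembly reaches Ising3DConformalLimit through r5 ∧ r6 alone.
What r2–r4 are: the parameter-free
NECESSARY CONDITION of Möbius invariance in law of the critical current ("conformal currents", the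
standing premise of the open cards
current-connection-invariance, moebius-restriction-currents, currents-are-stable-bridges,
linking-parity-cardy-disorder-circles), the
first typed current-sector statements of this summit with a clean (fully proved) import cone, and
the cheapest exponent-free numerical
kill test of that premise.
Lean: `Summit.CriticalPhenomena.Ising3DConformalLimit.Theses.MeanCurrentCircleLaw.CircleLaw ∧
Summit.CriticalPhenomena.Ising3DConformalLimit.Theses.MeanCurrentCircleLaw.HalfFluxLaw ∧
Summit.CriticalPhenomena.Ising3DConformalLimit.Theses.MeanCurrentCircleLaw.MeanCurrentExists ∧
Summit.CriticalPhenomena.Ising3DConformalLimit.Theses.MeanCurrentCircleLaw.MoebiusLimitExists ∧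
Summit.CriticalPhenomena.Ising3DConformalLimit.Theses.MeanCurrentCircleLaw.IsingEuclidUpgradeR4NonGaussian`
(the conjunction of the five item decls below — each conjunct's full one-line term is that item's
`Lean:` line; all nine items, the `rfl` checks that the inlined terms equal structured definitions
oddCond/effRes/kirchhoffFlow/meanCurrent, and the deciding theorem elaborate together in the
planner's Sketch.lean over imports RandomCurrents + LatticeGreenFunction + EffectiveResistance, rc
0)

## Assembly
Pure logic THROUGH THE IMPORTED COMPLEMENTS (declared): take (ρ, Δ, S) from MoebiusLimitExists;
IsingEuclidUpgradeR4NonGaussian applied to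
(ρ, S) gives HasNontrivialU4 S; ⟨ρ, Δ, S, …⟩ is the conjunct (root abbrev Ising3DConformalLimit =
Literature CritIsing3DConformalLimit).
The current-sector antecedents CircleLaw, HalfFluxLaw, MeanCurrentExists are carried but not
consumed (deciding theorem `closes`,
one line; verified sorry-free in the planner's Sketch.lean).

Rationale: WHY THIS LINE. Mechanism (card): pathwise KIRCHHOFF — for every current n with ∂n = {x,y} the flow
θ_n of the OBJECT is an exact unit flow from x to
y (node law at every site, at every mesh: canonical dimension 2, no renormalisation), intrinsic to
the abstract graph η(n) (hence
Aut-equivariant with no ordering rule and no averaging over rankings; rev 1 used the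
ranking-averaged Aizenman exploration backbone, of
which θ_n is the harmonic = uniform-spanning-tree average by Kirchhoff's theorem, LyonsPeres2016
§4.2) — plus the invariant-theory
lemma (U): the stabiliser of {x,y} in Möb(ℝ³∪∞) is conjugate to ℝ₊×O(3) and acts transitively on
ℝ³∖{x,y}, and a divergence-free
vector (flux) density with unit source at x invariant under it is FORCED to be B^{xy} (Beardon1983
§3; the CFT shadow is the
uniqueness of ⟨J_μ O O†⟩ for a conserved current, OsbornPetkou1994 §§2–3, transplanted to the
NON-LOCAL flux of the ℤ₂ model, which
has no local conserved current). Explicit dictionary: Kirchhoff flow of η(n) ↦ conserved current of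
dimension d−1 = 2; node law ↦ Ward
identity/charge normalisation; Stab(x,y)-rigidity ↦ the unique conformal three-point structure; flux
through surfaces ↦ the 2-form
(vector-density) transformation rule used in BipolarUniqueness; Gaussian rung ↦
transfer-current/Doob-h-transform Wronskian of the
random-walk path measure (LyonsPeres2016 §2.2, §4.2; doi:10.5948/upo9781614440222;
FernandezFrohlichSokal1992 ch. 2, 5). Sanity
rung d = 2: on the hexagonal lattice η(n) is a union of O(1)-model loops and ONE simple x–y defect
path, edge-disjoint and meeting at
most at x or y (a loop hanging at one vertex carries no current), so θ_n is exactly that path's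
indicator current and the loop ensemble + path are conformally invariant in law in the scaling limit
(CLE₃/SLE₃ world,
DuminilcopinLisQian2025 for the double-current version) — the object degenerates correctly where
conformal invariance is known.
CONTRAST fixing what is being tested: the unit electrical flow of the HOMOGENEOUS lattice ℤ³
(∇(G_x−G_y), the Coulomb pair; far field
|z|⁻³) is similarity-covariant but NOT inversion-invariant as a flux density, whereas B^{xy} (far
field |z|⁻⁴, circular field lines)
is the unique invariant one: the circle law is inversion content carried by the randomness of η, not
Coulomb content
(Literature.Barriers.CriticalPhenomena.ScaleCovarianceNotMoebius: similarity covariance leaves a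
free two-variable profile and a free
far-field exponent). Areas imported: finite electrical networks / effective resistance (Dirichlet
principle and Rayleigh monotonicity — in tree,
EffectiveResistance.lean, with Kirchhoff's edge formula PROVED as KirchhoffEdgeFormula_holds — plus
Tetali1991's potential formula
φ_z = (R_xy + R_zy − R_zx)/2), Möbius geometry of the two-point stabiliser, de
Rham currents (line-integral pairing), CFT Ward identities as heuristic. Sources: Aizenman1982 §9
(random-walk representation,
backbones), AizenmanDuminilCopinSidoravicius2015 §2 (currents, infinite volume),
AizenmanDuminilCopinAnnals2021 §§3–4, DuminilCopin2016
§2 (switching lemma — in tree, proved: currentSum_switching_holds), LyonsPeres2016 ch. 2 and §4.2,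
Tetali1991, DuminilcopinLisQian2025
(the only conformal-invariance THEOREM for random currents, d = 2), WinterJankeSchakel2008 (worm
geometry of 3D critical HT graphs = the
law of η, D = 1.7349(65): the numerics nearest to the kill test). What it does that prior routes do
not:
the spin-sector Theses do not touch currents and the three conformal-currents routes opened today
are typed over correlator ratios; this
is the first route with typed random-current items on ℤ³ whose import cone is fully proved (rev 2:
imports
RandomCurrents + LatticeGreenFunction + EffectiveResistance only — rev 1 dragged 44 unproved named
facts through CurrentExploration → … → GibbsStates and
through the lace-expansion barrier file that housed the Green asymptotics), an infrastructure the
four current-sector cards need, and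
the first lattice-honest, exponent-free test of the inversion (non-similarity) part of clause (ii);
negatives index (only 0772, SAW)
untouched.

RANKED CRUXES. #2 CircleLaw (crux) — for every J that is the N→∞ limit of the torus mean Kirchhoff
currents J_N (defining formula inlined: law of the critical sourced current, odd-bond unit
conductances, the library's effectiveResistance, Tetali's potential formula), every x ≠ y in ℝ³ and
every smooth compactly supported vector field φ with x, y ∉ tsupport φ: Σ'_u Σ_i
δ·φ(δu)_i·J([x/δ],[y/δ];u,i) → ∫ ⟨B^{xy}(z), φ(z)⟩ dz as δ → 0⁺ (card crux F3, "circle law"; ∀-form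
over the unique limit, guarded by MeanCurrentExists). [deps: MeanCurrentExists] [difficulty:
open-problem] (why it might fail: Rests on Möbius invariance IN LAW of the critical odd-current
graph η (unproved in d = 3) plus tightness of the signed harmonic flow (P[bond ∈ C_η(x)] ~ δ^(3−D),
D ≈ 1.73, ≫ δ² = |J|: the law lives on cancellations); a far-field exponent ≠ 4 or a
cubic-anisotropic remnant in lim J breaks it.) [AizenmanDuminilCopinSidoravicius2015 §2,
LyonsPeres2016 §2.2 and §4.2, Tetali1991, OsbornPetkou1994 §3, Beardon1983 §3,
DuminilcopinLisQian2025, WinterJankeSchakel2008,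
Summits/CriticalPhenomena/Ising3DConformalLimit/Ideas/mean-current-circle-law.md]
#3 HalfFluxLaw (crux) — for every such limit J, with sources x_m = (0,0,−m), y_m = (0,0,m+1): Σ over
u with u₂ = 0 and 4(u₀²+u₁²) ≤ (2m+1)² of J(x_m,y_m;u,e₂) → 1/2 as m → ∞ — the mean signed flux of
the critical current through the equatorial disc of the sphere with diameter [x,y] is one half
(solid-angle content of the circle law: under x↦0, y↦∞ the disc becomes a hemisphere; on the lattice
only the total plane flux = 1 is forced, by the node law). [deps: MeanCurrentExists, CircleLaw]
[difficulty: open-problem] (why it might fail: One surface, sharpest number: needs uniform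
integrability of the signed flux at the disc rim r = a (where |B| on the plane is not small) and no
lattice-scale staggering of J; any finite-size-stable deviation from 1/2 (worm MC + sparse Laplacian
solve, L = 32–128) kills it while similarity covariance survives.) [Beardon1983 §3,
doi:10.1214/ecp.v6-1041, WinterJankeSchakel2008, AizenmanDuminilCopinSidoravicius2015 §2,
Summits/CriticalPhenomena/Ising3DConformalLimit/Ideas/mean-current-circle-law.md]
#4 MeanCurrentExists (crux) — the torus mean Kirchhoff currents J_N(x,y;u,i) at β_c(3) converge as N
→ ∞ for all x, y, u ∈ ℤ³, i (existence of the infinite-volume mean sourced current; the technical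
crux F2 of the card in its weakest, first-moment form). [difficulty: L] (why it might fail: Not in
print for SOURCED currents at β_c(3) (ADS15 Thm 2.3 is sourceless/trace-level); θ_n is a non-local
functional of the η-cluster of x, whose diameter tail is controlled only by the borderline Σ_(∂B_R)
G(x,u)G(u,y)/G(x,y) with G ≤ C/|u| (needs η > 0 or an effective-resistance argument); torus
wrapping/parity along N could spoil plain convergence.) [AizenmanDuminilCopinSidoravicius2015 Thm
2.3, DuminilCopin2016 §2, AizenmanDuminilCopinAnnals2021 §4, LyonsPeres2016 §2.4,
Literature.Probability.LatticeModels.hasUniqueGibbsMeasure_criticalBeta,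
Literature.Probability.LatticeModels.currentSum_switching]
#5 MoebiusLimitExists (crux) — IMPORTED COMPLEMENT (verbatim stmt-CriticalPhenomena-1344, shared
with route PerfectScreening): the critical correlators on ℤ³ have a non-degenerate pointwise scaling
limit (ρ > 0 on (0,1], Δ > 0, S) that is Möbius covariant with dimension Δ — the conjunct minus
clause (iii); this route does not attack it. [difficulty: open-problem] (why it might fail:
Existence of the δ→0⁺ limit (all n), O(3) invariance and inversion covariance are each open on ℤ³
(ICM 2022 §8.4 p.29); no uniqueness mechanism in d = 3; ScaleCovarianceNotMoebius /
LiouvilleRigidity / BootstrapLatticeBlindness unmitigated.) [DuminilCopinICM2022 §8.1 p.25 and §8.4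
p.29, PolandRychkovVichi2019 §II eq. (2),
Literature.Probability.LatticeModels.CritIsing3DEuclideanLimit,
Literature.Barriers.CriticalPhenomena.ScaleCovarianceNotMoebius, stmt-CriticalPhenomena-1344]
#6 IsingEuclidUpgradeR4NonGaussian (crux) — IMPORTED COMPLEMENT (verbatim
stmt-CriticalPhenomena-0636, shared with IsingEuclidUpgrade / IsingCFTData / HyperoctahedralRP):
every non-degenerate pointwise scaling limit of the renormalised critical correlators on ℤ³ has U₄ ≢
0. [difficulty: open-problem] (why it might fail: No proof that U₄ ≢ 0 in d = 3: the double-current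
intersection probability at macroscopic separation must stay > 0 as δ → 0; RP long-range models on
ℤ³ (α < 3/2) are Gaussian (LongRangeTrivialityOnZ3).) [AizenmanDuminilCopinAnnals2021 eq. (3.11) and
Thm 1.2, Aizenman1982 Prop 5.1, DuminilCopinICM2022 §8.4,
Literature.Barriers.CriticalPhenomena.IsingTrivialityFromDimensionFour,
Literature.Barriers.CriticalPhenomena.LongRangeTrivialityOnZ3, stmt-CriticalPhenomena-0636]
#9 KirchhoffTorus (support) — (K) exact conservation at every finite volume: for N ≥ 2 and proj x ≠
proj y, Σ_i [J_N(x,y;u,i) − J_N(x,y;u−e_i,i)] = 1[proj u = proj x] − 1[proj u = proj y]. Proof: (i)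
parity — proj x, proj y are the only odd vertices of η(n), so they lie in one component; (ii)
unit-current theory on top of EffectiveResistance.lean (which has Dirichlet's principle, symmetry,
Rayleigh, the series bound, ℛ = ⊤ off the component and Kirchhoff's edge formula proved, but no
flows/potentials; ~250 lines): the Dirichlet infimum is attained, the minimiser is harmonic off
{v,w} and constant on the other components, the grounded Green kernel is symmetric, whence Tetali's
formula and the node law Σ_w θ_n(v,w) = 1[v = proj x] − 1[v = proj y]; θ_n antisymmetric
(effectiveResistance_comm), |θ_n| ≤ 1 (acyclic unit flow), θ_n = 0 on the diagonal and off the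
component (effectiveResistance_of_not_disjoint, toReal ⊤ = 0 — checked in the Sketch); (iii) Σ_n
P_N(n) = 1 (currentSum > 0 by criticalBeta_pos_holds and the path current;
summable_currentWeight_indicator_holds to exchange E with the finite sum); for N+1 ≥ 3 the six
neighbours proj(u ± e_i) are distinct. Validates the inlined definition. [difficulty: M]
[LyonsPeres2016 §2.2–2.4 and §4.2, Tetali1991,
Literature.Probability.LatticeModels.effectiveResistance_comm,
Literature.Probability.LatticeModels.KirchhoffEdgeFormula_holds,
Literature.Probability.LatticeModels.criticalBeta_pos_holds,
Literature.Probability.LatticeModels.summable_currentWeight_indicator_holds]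
#9 BipolarUniqueness (support) — (U) rigidity: if V : ℝ³ → ℝ³ is continuous off {x,y}, locally
integrable, has weak divergence δ_x − δ_y (∫⟨V,∇f⟩ = f(y) − f(x) for smooth compactly supported f)
and is invariant as a vector density under the inversion in every sphere through x and y (V(φz) =
(|z−c|⁴/r⁴)·Refl_((z−c)^⊥)(V z)), then V = B^(xy) off {x,y}. Proof: conjugate x↦0, y↦∞; the
inversions become reflections in a.e. plane through 0, generating O(3); an O(3)-equivariant
continuous field is f(|w|)ŵ, divergence-free forces f = c/|w|², unit flux c = 1/4π; pull back (B is
checked invariant). Pure Mathlib analysis; the glue in "conformal currents ⇒ CircleLaw".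
[difficulty: provable-now] [Beardon1983 §3, OsbornPetkou1994 §2, DiFrancescoMathieuSenechal1997
§4.1, BenedettiPetronio1992 ch. A]
#9 GaussianWronskianRung (support) — (W) the rung where the law is TRUE: for the simple-random-walk
x→y path measure on ℤ³ the mean signed current is exactly the discrete Wronskian J_RW(u,i) =
(g(u−x)g(y−u−e_i) − g(u+e_i−x)g(y−u))/(2g(y−x)), g = latticeGreen (= G_RW/3 ~ 1/(2π|z|)), and its
mesh-δ pairing with any smooth compactly supported φ off {x,y} converges to ∫⟨B^(xy),φ⟩; stated with
the classical nearest-neighbour Green asymptotics |g(z) − 1/(2π|z|)| ≤ K/|z|³ as an INLINE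
elementary hypothesis (rev 2: no barrier-file constant; the hypothesis is discharged verbatim by the
in-tree theorem LiuSlade2026_nnGreenAsymptotics_holds at d = 3, since gaussianAmp 3 = 3/(2π) and
jnorm = euclidNorm off 0 — import …LaceExpansionIsingGreenDecayProofs in the Theorems file only if
the unconditional corollary is wanted), which controls the bond differences to relative O(δ).
[difficulty: M] [LawlerLimic2010 Thm 4.3.1 and Thm 6.3.8, Lawler1991 Thm 1.5.4, LyonsPeres2016 §2.2
and §4.2, doi:10.5948/upo9781614440222, FernandezFrohlichSokal1992 ch. 5,
Literature.Barriers.CriticalPhenomena.SpreadOutIsing.LiuSlade2026_nnGreenAsymptotics_holds,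
Literature.Probability.LatticeModels.tendsto_latticeGreen_cofinite]

TWO-LAYER PLAN. Foreseen glued splits (k ≤ 3, depth 1), none filed now. CircleLaw ⇐ MeanCurrentTight
(sup_δ |Σ δφ_i(δu)J| ≤ C_φ: card F2, via the
switching lemma + Rayleigh monotonicity effectiveResistance_anti_graph + annulus-crossing counts of
η) → LimitIsInvariantFlow (every
subsequential distributional limit is a Stab(x,y)-invariant flux density with div = δ_x − δ_y — the
"conformal currents" input, first
moment only) → CircleLaw (glue = the distributional form of BipolarUniqueness). MeanCurrentExists ⇐
ClusterTight (P_N[C_η(proj x)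
leaves B_R] → 0 uniformly in N) → ClusterFunctionalConvergence (θ_n is a function of the finite
η-cluster of x; probabilities of local
η-events = ratios of correlators with forced/deleted bonds converge by Gibbs uniqueness at β_c,
hasUniqueGibbsMeasure_criticalBeta_holds)
→ MeanCurrentExists. HalfFluxLaw ⇐ CircleLaw → RimUniformIntegrability → HalfFluxLaw.

KILL CRITERIA. (a) NUMERICAL: worm-algorithm MC at β_c(3) = 0.22165463 — the Prokof'ev–Svistunov
high-temperature worm with head/tail pinned at x, y
samples EXACTLY the law of η with sources {x,y}; per sample θ_η is one sparse conjugate-gradient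
solve on C_η(x) (~L^1.73 sites) —
showing the equatorial half-flux ≠ 1/2 or a far-field decay |z|^(−2−a) with a ≠ 2 at 3σ, stable in L
= 32→128: file the run as
refutation evidence on HalfFluxLaw/CircleLaw and close the route `refuted:CircleLaw` (its dividend:
the premise "Möbius-invariant
critical currents" of cards current-connection-invariance, moebius-restriction-currents,
currents-are-stable-bridges is then dead for
the odd-current graph while clause (ii) for spins stays formally alive — record that in their
cards). (b) A proof that lim J is
similarity-covariant but keeps a free profile/exponent (the ScaleCovarianceNotMoebius scenario
realised) is the same kill. A mere
dependence of lim J on WHICH intrinsic unit flow is used (Kirchhoff on η vs Kirchhoff on the traced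
cluster {n_e > 0} vs the Aizenman
backbone) is not a kill of the mechanism but splits the thesis: restate r2–r4 for the flow that
survives, once. (c) MeanCurrentExists
refuted (non-convergence in N) ⇒ repair by restating r2–r4 along even N / Cesàro / lim sup–lim inf
(one --restate). (d) The conformal-currents cards now have
routes (CurrentConnectionInvariance, MoebiusRestrictionCurrents, LinkingParityCircles — all typed
over correlator ratios, none wants a
flow decl): if one of them adopts CircleLaw/MeanCurrentExists as shared items this route is
superseded into it, not before.
(e) MoebiusLimitExists or 0636 refuted ⇒ the conjunct itself falls (all routes). Proved elsewhere:
MoebiusLimitExists ∧ 0636 proved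
moots the assembly but not r2–r4, which stay wanted as theorems.

NOT DECOMPOSED YET. Tightness F2 (absolute first moment of the paired flow, needs the LAW, i.e. the
definition request D1); the distributional version of
(U); comparison of intrinsic flows (η-Kirchhoff vs traced-Kirchhoff vs Aizenman backbone — the last
only once Current.exploreAt lives in
a module with a proved import cone); the far-field statement |J(z)| ≃ δ²|x−y|²/(4π|z|⁴)·(d̂ −
2(d̂·ẑ)ẑ) (exponent exactly 4, isotropic
magnitude); the bisector-plane profile a²/(π(r²+a²)²); the d = 2 full-plane analogue (planar bipolar
field, κ-free; on the hexagonal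
lattice θ = defect-path current) and the d ≥ 5 rung; the four-source mean current (cross-ratio
functions, pairing probabilities as
fluxes) — all layer-2 or later. The chain bound |J_N(u→v)| ≤ P_N[u ∈ C_η(proj x)] ≤
⟨σ_xσ_u⟩⟨σ_uσ_y⟩/⟨σ_xσ_y⟩ (torus, β_c: |θ| ≤ 1, η ⊂ traced(n₁) ⊂
traced(n₁+n₂) and the switching lemma currentSum_switching_holds; provable, not filed).

CHEAPEST FALSIFIER. HalfFluxLaw by worm MC: L³ tori, L = 32, 48, 64, 96, sources at axial distance
2m+1 = L/4, β = 0.22165463; estimator = mean over worm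
samples η of Σ_(disc bonds) θ_η, θ_η from one sparse Laplacian solve on the x-cluster of η (unit
conductances; milliseconds per
sample); prediction 1/2 with O(m⁻¹) drift; |θ_η| ≤ 1 bondwise and the disc sum is a signed flux of a
unit flow, so ~10⁶ samples per L
give ±0.005. CONTROLS that must reproduce the answer with the same code: (i) the SRW path measure
(exact discrete Wronskian: a
deterministic lattice sum of latticeGreen values — no MC), (ii) d = 5 Ising at β_c (Gaussian rung
expected). Not run here (route-repair
is one-shot and the hub is compute-free); a refuter with kit should run (i) first (minutes), then
the L = 32, 48 worm runs (hours).
The resistance formula for θ was checked this session in exact arithmetic on random finite graphs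
(node law, antisymmetry,
|θ| ≤ 1, = grounded-Laplacian solve, 0 on sourceless components).

NUMBERS. β_c(3) = 0.221654626(5); Δ_σ = 0.5181489(10), η = 0.036298(2) (bootstrap) — NONE enters the
prediction. High-temperature-graph fractal
dimension of 3D critical Ising D = 1.7349(65) (WinterJankeSchakel2008) ⇒ P[bond ∈ C_η(x)] ~ δ^(3−D)
≈ δ^1.27 ≫ δ² ≈ |J| (cancellation
ratio δ^0.73). Predictions: half-flux 1/2; bisector density a²/(π(r²+a²)²), tail r⁻⁴; far field |J|
= δ²|x−y|²/(4π|z|⁴)(1+o(1)),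
direction d̂ − 2(d̂·ẑ)ẑ (B checked numerically at rev 1: disc flux 0.50000, inversion-invariant to
1e−16, div B = 0). Contrast (electric current of the homogeneous lattice / similarity-only): far
field |z|⁻³, free exponent
|x−y|^a|z|^(−2−a). latticeGreen(z) = 1/(2π|z|) + O(|z|⁻³) (gaussianAmp 3 / 3 = 1/(2π)). Items: 9 (5
cruxes of which 2
imported-shared, 3 support, 1 assembly); import cone after rev 2: RandomCurrents,
LatticeGreenFunction, EffectiveResistance (+ the Statement's own)
— 0 unproved named facts (census this session: every `def … : Prop` of RandomCurrents,
LatticeGreenFunction, TorusFourier, ScalingLimit,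
EffectiveResistance has a `_holds`; EffectiveResistance imports Mathlib only).

DEFINITION REQUESTS. D1 `sourcedCurrentLaw (d : ℕ) (β : ℝ) (A : Finset (Site d))` — the
infinite-volume random current on ℤ^d with finite source set A
(weak limit of the torus / free-b.c. laws ∝ 1{∂n = A} w_β(n); ADS15 §2, ADC21 §4), topic
Literature/Probability/LatticeModels — needed for
F2-tightness and every law-level current statement (also wanted by the four current-sector cards and
by `doubleCurrentU4Identity` on
stmt-0636). D2 (rev 2) `unitCurrentFlow G c a b : V → V → ℝ` next to the existing
`effectiveResistance`
(EffectiveResistance.lean, Mathlib-only imports): the unit electrical flow with Tetali's potential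
(ℛ_ab + ℛ_zb − ℛ_za)/2, its node
law, |flow| ≤ 1 and Thomson's principle — with it r2–r4 and (K) can be `--restate`d over a
60-character head instead of the inlined
1.2 kB torus formula, and (K) becomes provable-now; it must keep that file's Mathlib-only import
closure. D2' `backboneMeanCurrent` (rev 1's D2) only after Current.exploreAt is re-homed in a module
with a proved import closure (today CurrentExploration → … → GibbsStates carries aizenman_higuchi,
bodineau_translationInvariant).
D3 `bipolarField (x y z : EuclideanSpace ℝ (Fin 3))` (topic
Summits/CriticalPhenomena/Ising3DConformalLimit/Theorems or Literature/Geometry).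

Novelty: Searches (2026-08-15, rev-1 plancard session): `lit search --hybrid "random current backbone
conformal invariance mean flux"` (12 book hits, none
on signed backbone flux: Lawler 2005, Grimmett RCM, Itzykson–Drouffe …); `lit galaxy search "random
current" --star all` (21 rows, 0
relevant); `lit galaxy search "expected number of signed crossings" --star all` (5: LyonsPeres2016 =
the transfer-current identity, Bohmian
texts); `lit galaxy search "high-temperature graphs" --star all` (4: Wipf LNP 992 worm chapter);
crossref "geometric properties 3D Ising
high-temperature graphs worm" → WinterJankeSchakel2008 (doi:10.1103/physreve.77.061108: unsigned
fractal dimensions only); crossref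
"Osborn Petkou conserved current three-point" → OsbornPetkou1994 (doi:10.1006/aphy.1994.1045);
crossref Doyle–Snell
(doi:10.5948/upo9781614440222), Schramm 2001 (doi:10.1214/ecp.v6-1041); the card's own audit
(refuter-novelty-audit-…-7-g2-0) had galaxy
bm25 0/20 relevant. Searches (2026-08-15, rev-2 repair session, object = Kirchhoff flow of the
odd-current graph): `lit galaxy search
"effective resistance" --star all` (30 rows, 0 relevant: travel guides / datasheets), `lit galaxy
search "random resistor network at the
percolation threshold" --star all` (6: Stanley–Ostrowsky "On Growth and Form" 1986, Gouyet 1996,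
Feder–Flekkøy–Hansen, Le Méhauté —
random-resistor-network CONDUCTANCE EXPONENTS of critical percolation clusters, never the mean
signed flow field or its covariance),
`lit galaxy search "uni  [refs: 10.1103/physreve.77.061108:, 10.1006/aphy.1994.1045, 10.5948/upo9781614440222, 10.1214/ecp.v6-1041, 10.1007/BF01046996, doi:10.1103/physreve.77.061108, doi:10.1006/aphy.1994.1045, doi:10.5948/upo9781614440222, doi:10.1214/ecp.v6-1041, LyonsPeres2016, WinterJankeSchakel2008, OsbornPetkou1994, Tetali1991, DuminilcopinLisQian2025, AizenmanDuminilCopinSidoravicius2015, Aizenman1982]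

Barriers (technique_class: conserved-current-rigidity, random-current-backbone): - technique_class: conserved-current-rigidity, random-current-backbone
- Literature.Barriers.CriticalPhenomena.ScaleCovarianceNotMoebius: consistent, and the route is
built on the gap it names — under Euclidean + scale covariance alone the limit flow keeps a free
meridian profile and a free far-field exponent |x−y|^a|z|^(−2−a); CircleLaw/HalfFluxLaw are exactly
the inversion content (a = 2, circles, 1/2). No similarity ⇒ Möbius upgrade is claimed anywhere.
- Literature.Barriers.CriticalPhenomena.LiouvilleRigidity: used, not suffered — only global Möbius
maps occur; rigidity of the two-puncture stabiliser (transitive on ℝ³∖{x,y}) is what removes every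
free parameter (BipolarUniqueness).
- Literature.Barriers.CriticalPhenomena.IsingTrivialityFromDimensionFour: applies to
dimension-uniform NON-TRIVIALITY arguments; r2–r4 are first-moment covariance statements,
legitimately dimension-uniform in form (true for the Gaussian rung, expected in d ≥ 5), and claim
nothing about clause (iii), which is imported (0636) with this barrier cited on it.
- Literature.Barriers.CriticalPhenomena.LongRangeTrivialityOnZ3: same remark — no
interaction-specific non-triviality claim is made by the current-sector items; 0636 carries it.
- Literature.Barriers.CriticalPhenomena.BootstrapLatticeBlindness: not engaged — every item is a
statement about lattice objects (torus currents, criticalCorr), not about CFT data.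
- Literature.Barriers.CriticalPhenomena.TransverseCrossingsNeedNotMeet: not engaged (no b

History (route lifecycle, newest last):
- 2026-08-15T16:53:47Z · rev 2: restated CircleLaw (stmt-CriticalPhenomena-7080), HalfFluxLaw (stmt-CriticalPhenomena-7081), MeanCurrentExists (stmt-CriticalPhenomena-7082), KirchhoffTorus (stmt-CriticalPhenomena-7083), GaussianWronskianRung (stmt-CriticalPhenomena-7085) — route-repair (cone, gen 2): imports CurrentExploration + Barriers…LaceE (planner-rrepair-CriticalPhenomena-MeanCurrentC-799e5623-g2-0)
- 2026-08-24T22:49:53Z · DORMANT — reconciler: no traction for 7.1 d (last activity item-evidence-added at 2026-08-17T18:53:45Z); parked, not closed — `ledger route dormant route-CriticalPhenomen (operator:999:1960801)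
- 2026-08-27T15:23:32Z · REACTIVATED — reconciler: reactivated — activity statement-checked at 2026-08-27T13:50:46Z after parking at 2026-08-24T22:49:53Z (operator:999:1388427)
- 2026-08-29T19:35:13Z · DORMANT — census g0: costume|duplicate of —; reader census-reader-38-g0 (operator:999:1341534)

sub-problem: Ising3DConformalLimit · status: dormant · opened planner-plancard-CriticalPhenomena-Ising3DCon-de03368a-0 2026-08-15T12:01:46Z · rev 3 · ledger route-CriticalPhenomena-MeanCurrentCircleLaw
GENERATED by the gate from the ledger (D-0016/17). Provers cite these decls: `theorem foo : Summit.CriticalPhenomena.Ising3DConformalLimit.Theses.MeanCurrentCircleLaw.<Decl> := …` in Summits/CriticalPhenomena/Ising3DConformalLimit/Theorems/<Name>.lean.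
-/

namespace Summit.CriticalPhenomena.Ising3DConformalLimit.Theses.MeanCurrentCircleLaw

open scoped BigOperators Topology Manifold Classical MeasureTheory ProbabilityTheory Matrix InnerProductSpace ComplexConjugate ContinuousMap
open Filter Set Function TopologicalSpace MeasureTheory

attribute [summit_statement] _root_.Ising3DConformalLimit

-- earlier CircleLaw (stmt-CriticalPhenomena-7080, replaced 2026-08-15T16:53:47Z -> stmt-CriticalPhenomena-11238): retired by None — ∀ J : Literature.Probability.LatticeModels.Site 3 → Literature.Probability.LatticeModels.Site 3 → Literature.Probability.LatticeModels.Site 3 → Fin 3 → ℝ, (∀ (x y u : Literature.Probability.LatticeModels.Site 3) (i : Fin 3), Filter.Tendsto (fun N : ℕ => (((Fintype.card 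
/-- item stmt-CriticalPhenomena-11238 · crux · rank 2 · open · by planner
why it might fail: Rests on Möbius invariance IN LAW of the critical odd-current graph η (unproved in d = 3) plus tightness of the signed harmonic flow (P[bond ∈ C_η(x)] ~ δ^(3−D), D ≈ 1.73 ≫ δ² = |J|: the law lives on cancellations); a far-field exponent ≠ 4 or a cubic-anisotropic remnant in lim J breaks it.
sources: AizenmanDuminilCopinSidoravicius2015 §2, LyonsPeres2016 §2.2 and §4.2, Tetali1991, OsbornPetkou1994 §3, Beardon1983 §3, DuminilcopinLisQian2025
[crux] r2 (card F3, circle law). rev-2 OBJECT: J = lim_N J_N with J_N(x,y;u,i) = E_N[θ_n(proj u,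
proj(u+e_i))] under the critical sourced torus current (law ∝ 1{∂n = {proj x} Δ {proj y}}
w_{β_c(3)}(n) on (ℤ/(N+1)ℤ)³), θ_n = the unit Kirchhoff (electrical) flow from proj x to proj y on
the odd-bond graph η(n) = {e : n_e odd} with unit conductances, typed choice-free as θ_n(v,w) =
1_η(vw)·[(R(v,y)−R(v,x)) − (R(w,y)−R(w,x))]/2, R(v,w) = (effectiveResistance torus 1_η {v}
{w}).toReal from the tree's EffectiveResistance.lean (Dirichlet principle; 0 on the diagonal, ⊤ ↦ 0
off the component), Tetali's potential formula. CLAIM: for every such limit J, every x ≠ y in ℝ³ and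
every smooth compactly supported vector field φ with x, y ∉ tsupport φ: Σ'_u Σ_i
δ·φ(δu)_i·J([x/δ],[y/δ];u,i) → ∫⟨B^{xy}(z), φ(z)⟩ dz as δ → 0⁺, B^{xy}(z) =
(|x−y|/(4π|z−x||z−y|))·((z−x)/|z−x|² − (z−y)/|z−y|²) (∀-form over the unique limit, guarded by
MeanCurrentExists). Restated 2026-08-15 (cone repair): rev 1 used the ranking-averaged Aizenman
backbone (Current.exploreAt), whose module cone carried unproved facts; θ_n is its
harmonic/UST-averaged, rule-free representative. [deps: MeanCurrentExists] [difficulty: open-pr -/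
@[route_item "route-CriticalPhenomena-MeanCurrentCircleLaw", crux]
def CircleLaw : Prop :=
  ∀ J : Literature.Probability.LatticeModels.Site 3 → Literature.Probability.LatticeModels.Site 3 → Literature.Probability.LatticeModels.Site 3 → Fin 3 → ℝ, (∀ (x y u : Literature.Probability.LatticeModels.Site 3) (i : Fin 3), Filter.Tendsto (fun N : ℕ => (∑' n : Literature.Probability.LatticeModels.Current (Literature.Probability.LatticeModels.torusGraph 3 (N+1)), (if n.sources = symmDiff {Literature.Probability.LatticeModels.Torus.proj (N+1) x} {Literature.Probability.LatticeModels.Torus.proj (N+1) y} then n.weight (Literature.Probability.LatticeModels.criticalBeta 3) else 0) * (let c : Sym2 (Literature.Probability.LatticeModels.TorusSite 3 (N+1)) → NNReal := fun e => if h : e ∈ (Literature.Probability.LatticeModels.torusGraph 3 (N+1)).edgeFinset then (if Odd (n ⟨e, h⟩) then 1 else 0) else 0; let R : Literature.Probability.LatticeModels.TorusSite 3 (N+1) → Literature.Probability.LatticeModels.TorusSite 3 (N+1) → ℝ := fun v w => (Literature.Probability.LatticeModels.effectiveResistance (Literature.Probability.LatticeModels.torusGraph 3 (N+1)) c {v}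 {w}).toReal; (c s(Literature.Probability.LatticeModels.Torus.proj (N+1) u, Literature.Probability.LatticeModels.Torus.proj (N+1) (u + Pi.single i 1)) : ℝ) * ((R (Literature.Probability.LatticeModels.Torus.proj (N+1) u) (Literature.Probability.LatticeModels.Torus.proj (N+1) y) - R (Literature.Probability.LatticeModels.Torus.proj (N+1) u) (Literature.Probability.LatticeModels.Torus.proj (N+1) x)) - (R (Literature.Probability.LatticeModels.Torus.proj (N+1) (u + Pi.single i 1)) (Literature.Probability.LatticeModels.Torus.proj (N+1) y) - R (Literature.Probability.LatticeModels.Torus.proj (N+1) (u + Pi.single i 1)) (Literature.Probability.LatticeModels.Torus.proj (N+1) x))) / 2)) / Literature.Probability.LatticeModels.currentSum (Literature.Probability.LatticeModels.torusGraph 3 (N+1)) (Literature.Probability.LatticeModels.criticalBeta 3) (symmDiff {Literature.Probability.LatticeModels.Torus.proj (N+1) x} {Literature.Probability.LatticeModels.Torus.proj (N+1) y})) Filter.atTop (nhds (J x y u i))) → ∀ (x y : EuclideanSpace ℝ (Fin 3)), x ≠ y → ∀ (φ : EuclideanSpace ℝ (Fin 3) → EuclideanSpace ℝ (Fin 3)),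 ContDiff ℝ ((⊤ : ℕ∞) : WithTop ℕ∞) φ → HasCompactSupport φ → x ∉ tsupport φ → y ∉ tsupport φ → Filter.Tendsto (fun δ : ℝ => ∑' u : Literature.Probability.LatticeModels.Site 3, ∑ i : Fin 3, δ * (φ (δ • ((EuclideanSpace.equiv (Fin 3) ℝ).symm (fun j => ((u j : ℤ) : ℝ))))) i * J (Literature.Probability.LatticeModels.latticeApprox δ x) (Literature.Probability.LatticeModels.latticeApprox δ y) u i) (nhdsWithin (0:ℝ) (Set.Ioi 0)) (nhds (∫ z, inner ℝ ((‖x - y‖ / (4 * Real.pi * ‖z - x‖ * ‖z - y‖)) • ((‖z - x‖ ^ 2)⁻¹ • (z - x) - (‖z - y‖ ^ 2)⁻¹ • (z - y))) (φ z)))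

-- earlier HalfFluxLaw (stmt-CriticalPhenomena-7081, replaced 2026-08-15T16:53:47Z -> stmt-CriticalPhenomena-11239): retired by None — ∀ J : Literature.Probability.LatticeModels.Site 3 → Literature.Probability.LatticeModels.Site 3 → Literature.Probability.LatticeModels.Site 3 → Fin 3 → ℝ, (∀ (x y u : Literature.Probability.LatticeModels.Site 3) (i : Fin 3), Filter.Tendsto (fun N : ℕ => (((Fintype.car
/-- item stmt-CriticalPhenomena-11239 · crux · rank 3 · open · by planner
why it might fail: One surface, sharpest number: needs uniform integrability of the signed flux at the disc rim r = a (|B| is not small there) and no lattice-scale staggering of J; any finite-size-stable deviation from 1/2 (worm MC + Laplacian solve, L = 32–128) kills it while similarity covariance survives.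
sources: Beardon1983 §3, doi:10.1214/ecp.v6-1041, WinterJankeSchakel2008, AizenmanDuminilCopinSidoravicius2015 §2, Summits/CriticalPhenomena/Ising3DConformalLimit/Ideas/mean-current-circle-law.md
[crux] r3 (cheapest sharp instance). rev-2 OBJECT: J = lim_N J_N with J_N(x,y;u,i) = E_N[θ_n(proj u,
proj(u+e_i))] under the critical sourced torus current (law ∝ 1{∂n = {proj x} Δ {proj y}}
w_{β_c(3)}(n) on (ℤ/(N+1)ℤ)³), θ_n = the unit Kirchhoff (electrical) flow from proj x to proj y on
the odd-bond graph η(n) = {e : n_e odd} with unit conductances, typed choice-free as θ_n(v,w) =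
1_η(vw)·[(R(v,y)−R(v,x)) − (R(w,y)−R(w,x))]/2, R(v,w) = (effectiveResistance torus 1_η {v}
{w}).toReal from the tree's EffectiveResistance.lean (Dirichlet principle; 0 on the diagonal, ⊤ ↦ 0
off the component), Tetali's potential formula. CLAIM: for every such limit J, with sources x_m =
(0,0,−m), y_m = (0,0,m+1): Σ over u with u₂ = 0 and 4(u₀²+u₁²) ≤ (2m+1)² of J(x_m,y_m;u,e₂) → 1/2 as
m → ∞ (mean signed flux through the equatorial disc of the sphere with diameter [x,y]; on the
lattice only the total plane flux = 1 is forced, by the node law). Restated 2026-08-15 (cone repair,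
same object change as CircleLaw). [deps: MeanCurrentExists, CircleLaw] [difficulty: open-problem] -/
@[route_item "route-CriticalPhenomena-MeanCurrentCircleLaw", crux]
def HalfFluxLaw : Prop :=
  ∀ J : Literature.Probability.LatticeModels.Site 3 → Literature.Probability.LatticeModels.Site 3 → Literature.Probability.LatticeModels.Site 3 → Fin 3 → ℝ, (∀ (x y u : Literature.Probability.LatticeModels.Site 3) (i : Fin 3), Filter.Tendsto (fun N : ℕ => (∑' n : Literature.Probability.LatticeModels.Current (Literature.Probability.LatticeModels.torusGraph 3 (N+1)), (if n.sources = symmDiff {Literature.Probability.LatticeModels.Torus.proj (N+1) x} {Literature.Probability.LatticeModels.Torus.proj (N+1) y} then n.weight (Literature.Probability.LatticeModels.criticalBeta 3) else 0) * (let c : Sym2 (Literature.Probability.LatticeModels.TorusSite 3 (N+1)) → NNReal := fun e => if h : e ∈ (Literature.Probability.LatticeModels.torusGraph 3 (N+1)).edgeFinset then (if Odd (n ⟨e, h⟩) then 1 else 0) else 0; let R : Literature.Probability.LatticeModels.TorusSite 3 (N+1) → Literature.Probability.LatticeModels.TorusSite 3 (N+1) → ℝ := fun v w => (Literature.Probability.LatticeModels.effectiveResistance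 (Literature.Probability.LatticeModels.torusGraph 3 (N+1)) c {v} {w}).toReal; (c s(Literature.Probability.LatticeModels.Torus.proj (N+1) u, Literature.Probability.LatticeModels.Torus.proj (N+1) (u + Pi.single i 1)) : ℝ) * ((R (Literature.Probability.LatticeModels.Torus.proj (N+1) u) (Literature.Probability.LatticeModels.Torus.proj (N+1) y) - R (Literature.Probability.LatticeModels.Torus.proj (N+1) u) (Literature.Probability.LatticeModels.Torus.proj (N+1) x)) - (R (Literature.Probability.LatticeModels.Torus.proj (N+1) (u + Pi.single i 1)) (Literature.Probability.LatticeModels.Torus.proj (N+1) y) - R (Literature.Probability.LatticeModels.Torus.proj (N+1) (u + Pi.single i 1)) (Literature.Probability.LatticeModels.Torus.proj (N+1) x))) / 2)) / Literature.Probability.LatticeModels.currentSum (Literature.Probability.LatticeModels.torusGraph 3 (N+1)) (Literature.Probability.LatticeModels.criticalBeta 3) (symmDiff {Literature.Probability.LatticeModels.Torus.proj (N+1) x} {Literature.Probability.LatticeModels.Torus.proj (N+1) y})) Filter.atTop (nhds (J x y u i))) → Filter.Tendsto (fun m : ℕ => ∑' u : Literature.Probability.LatticeModels.Site 3, (if u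 2 = 0 ∧ 4 * ((u 0) ^ 2 + (u 1) ^ 2) ≤ (2 * (m:ℤ) + 1) ^ 2 then J (Pi.single 2 (-(m:ℤ)) : Literature.Probability.LatticeModels.Site 3) (Pi.single 2 ((m:ℤ) + 1) : Literature.Probability.LatticeModels.Site 3) u 2 else 0)) Filter.atTop (nhds ((1:ℝ) / 2))

-- earlier MeanCurrentExists (stmt-CriticalPhenomena-7082, replaced 2026-08-15T16:53:47Z -> stmt-CriticalPhenomena-11240): retired by None — ∃ J : Literature.Probability.LatticeModels.Site 3 → Literature.Probability.LatticeModels.Site 3 → Literature.Probability.LatticeModels.Site 3 → Fin 3 → ℝ, (∀ (x y u : Literature.Probability.LatticeModels.Site 3) (i : Fin 3), Filter.Tendsto (fun N : ℕ => (((Finty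
/-- item stmt-CriticalPhenomena-11240 · crux · rank 4 · open · by planner
why it might fail: Not in print for SOURCED currents at β_c(3) (ADS15 Thm 2.3 is sourceless); θ_n is a non-local functional of the η-cluster of x, whose diameter tail has only the borderline bound Σ_(∂B_R) G(x,u)G(u,y)/G(x,y), G ≤ C/|u| (needs η > 0 or a resistance argument); parity in N may spoil plain convergence.
sources: AizenmanDuminilCopinSidoravicius2015 Thm 2.3, DuminilCopin2016 §2, AizenmanDuminilCopinAnnals2021 §4, LyonsPeres2016 §2.4, Literature.Probability.LatticeModels.hasUniqueGibbsMeasure_criticalBeta, Literature.Probability.LatticeModels.currentSum_switching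
[crux] r4 (technical crux F2, first-moment form). rev-2 OBJECT: J = lim_N J_N with J_N(x,y;u,i) =
E_N[θ_n(proj u, proj(u+e_i))] under the critical sourced torus current (law ∝ 1{∂n = {proj x} Δ
{proj y}} w_{β_c(3)}(n) on (ℤ/(N+1)ℤ)³), θ_n = the unit Kirchhoff (electrical) flow from proj x to
proj y on the odd-bond graph η(n) = {e : n_e odd} with unit conductances, typed choice-free as
θ_n(v,w) = 1_η(vw)·[(R(v,y)−R(v,x)) − (R(w,y)−R(w,x))]/2, R(v,w) = (effectiveResistance torus 1_η
{v} {w}).toReal from the tree's EffectiveResistance.lean (Dirichlet principle; 0 on the diagonal, ⊤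
↦ 0 off the component), Tetali's potential formula. CLAIM: the torus mean Kirchhoff currents
J_N(x,y;u,i) converge as N → ∞ for all x, y, u ∈ ℤ³ and i (existence of the infinite-volume mean
sourced current). Route: θ_n is a [−1,1]-valued function of the finite η-cluster of proj x; local
η-event probabilities are ratios of correlators with forced/deleted bonds (Gibbs uniqueness at β_c:
hasUniqueGibbsMeasure_criticalBeta_holds) + cluster tightness via the switching bound P_N[u ∈
C_η(x)] ≤ ⟨σ_xσ_u⟩⟨σ_uσ_y⟩/⟨σ_xσ_y⟩. Restated 2026-08-15 (cone repair, same object change as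
CircleLaw). [difficulty: L] -/
@[route_item "route-CriticalPhenomena-MeanCurrentCircleLaw", crux]
def MeanCurrentExists : Prop :=
  ∃ J : Literature.Probability.LatticeModels.Site 3 → Literature.Probability.LatticeModels.Site 3 → Literature.Probability.LatticeModels.Site 3 → Fin 3 → ℝ, ∀ (x y u : Literature.Probability.LatticeModels.Site 3) (i : Fin 3), Filter.Tendsto (fun N : ℕ => (∑' n : Literature.Probability.LatticeModels.Current (Literature.Probability.LatticeModels.torusGraph 3 (N+1)), (if n.sources = symmDiff {Literature.Probability.LatticeModels.Torus.proj (N+1) x} {Literature.Probability.LatticeModels.Torus.proj (N+1) y} then n.weight (Literature.Probability.LatticeModels.criticalBeta 3) else 0) * (let c : Sym2 (Literature.Probability.LatticeModels.TorusSite 3 (N+1)) → NNReal := fun e => if h : e ∈ (Literature.Probability.LatticeModels.torusGraph 3 (N+1)).edgeFinset then (if Odd (n ⟨e, h⟩) then 1 else 0) else 0; let R : Literature.Probability.LatticeModels.TorusSite 3 (N+1) → Literature.Probability.LatticeModels.TorusSite 3 (N+1) → ℝ := fun v w => (Literature.Probability.LatticeModels.effectiveResistance (Literature.Probability.LatticeModels.torusGraph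 3 (N+1)) c {v} {w}).toReal; (c s(Literature.Probability.LatticeModels.Torus.proj (N+1) u, Literature.Probability.LatticeModels.Torus.proj (N+1) (u + Pi.single i 1)) : ℝ) * ((R (Literature.Probability.LatticeModels.Torus.proj (N+1) u) (Literature.Probability.LatticeModels.Torus.proj (N+1) y) - R (Literature.Probability.LatticeModels.Torus.proj (N+1) u) (Literature.Probability.LatticeModels.Torus.proj (N+1) x)) - (R (Literature.Probability.LatticeModels.Torus.proj (N+1) (u + Pi.single i 1)) (Literature.Probability.LatticeModels.Torus.proj (N+1) y) - R (Literature.Probability.LatticeModels.Torus.proj (N+1) (u + Pi.single i 1)) (Literature.Probability.LatticeModels.Torus.proj (N+1) x))) / 2)) / Literature.Probability.LatticeModels.currentSum (Literature.Probability.LatticeModels.torusGraph 3 (N+1)) (Literature.Probability.LatticeModels.criticalBeta 3) (symmDiff {Literature.Probability.LatticeModels.Torus.proj (N+1) x} {Literature.Probability.LatticeModels.Torus.proj (N+1) y})) Filter.atTop (nhds (J x y u i))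

/-- item stmt-CriticalPhenomena-1344 · crux · rank 5 · open · by planner
why it might fail: Existence of the δ→0⁺ limit (all n), O(3) invariance and inversion covariance are each open on ℤ³ (ICM 2022 §8.4 p.29); no uniqueness mechanism in d = 3; ScaleCovarianceNotMoebius / LiouvilleRigidity / BootstrapLatticeBlindness unmitigated.
sources: DuminilCopinICM2022 §8.1 p.25 and §8.4 p.29, PolandRychkovVichi2019 §II eq. (2), Literature.Probability.LatticeModels.CritIsing3DEuclideanLimit, Literature.Barriers.CriticalPhenomena.ScaleCovarianceNotMoebius, stmt-CriticalPhenomena-1344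
[crux] r5 = MoebLim (IMPORTED COMPLEMENT, lowest rank): the critical Ising correlators on ℤ³ have a
non-degenerate pointwise scaling limit (ρ > 0 on (0,1], Δ > 0, S) that is Möbius covariant with
dimension Δ — the conjunct Ising3DConformalLimit minus clause (iii). Written verbatim as the
conjunct's definiens without '∧ HasNontrivialU4 S' so that other routes filing the same complement
attach here. This route does not attack existence, rotation or inversion covariance; it bets on the
covariance lines (IsingEuclidUpgrade r5/r6 = items 0637/0638, IsingCFTData r2 = 0665, cards
hyperoctahedral-rp-rigidity / inversion-first-moebius-from-translations). S may be taken 0 off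
NonCoincident, so no coincident-configuration junk obstructs the existential. -/
@[route_item "route-CriticalPhenomena-MeanCurrentCircleLaw", crux]
def MoebiusLimitExists : Prop :=
  ∃ (ρ : ℝ → ℝ) (Δ : ℝ) (S : Literature.Probability.LatticeModels.CorrFamily 3), (∀ δ ∈ Set.Ioc (0:ℝ) 1, 0 < ρ δ) ∧ 0 < Δ ∧ Literature.Probability.LatticeModels.HasPointwiseScalingLimit (Literature.Probability.LatticeModels.criticalCorr 3) ρ S ∧ Literature.Probability.LatticeModels.IsNondegenerateTwoPoint S ∧ Literature.Probability.LatticeModels.IsMoebiusCovariant Δ S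

/-- item stmt-CriticalPhenomena-0636 · crux · rank 6 · open · by planner
why it might fail: No proof that U₄ ≢ 0 in d = 3: the double-current intersection probability at macroscopic separation must stay > 0 as δ → 0; RP long-range models on ℤ³ (α < 3/2) are Gaussian (LongRangeTrivialityOnZ3).
sources: AizenmanDuminilCopinAnnals2021 eq. (3.11) and Thm 1.2, Aizenman1982 Prop 5.1, DuminilCopinICM2022 §8.4, Literature.Barriers.CriticalPhenomena.IsingTrivialityFromDimensionFour, Literature.Barriers.CriticalPhenomena.LongRangeTrivialityOnZ3
Crux r4 (non-triviality in d=3): every non-degenerate pointwise scaling limit S of the renormalised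
critical Ising correlators on Z^3 has connected four-point function U4 ≢ 0 on non-coincident
configurations. Intended tool: the random-current identity U4(x,y,z,t) =
−2⟨σxσy⟩⟨σzσt⟩·P^{xy,zt}[C_{n1+n2}(x) ∩ C_{n1+n2}(z) ≠ ∅] (Aizenman 1982; ADC2021 arXiv:1912.07973
eq. (3.11)): non-Gaussianity ⇔ the intersection probability of the two double-current clusters at
macroscopic separation does not vanish as δ → 0. Contrast: for d ≥ 4 every such limit IS Gaussian
(Literature.Probability.LatticeModels.highDim_triviality). Its negation refutes the conjunct
Ising3DConformalLimit itself. -/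
@[route_item "route-CriticalPhenomena-MeanCurrentCircleLaw", crux]
def IsingEuclidUpgradeR4NonGaussian : Prop :=
  ∀ (ρ : ℝ → ℝ) (S : Literature.Probability.LatticeModels.CorrFamily 3), (∀ δ ∈ Set.Ioc (0:ℝ) 1, 0 < ρ δ) → Literature.Probability.LatticeModels.HasPointwiseScalingLimit (Literature.Probability.LatticeModels.criticalCorr 3) ρ S → Literature.Probability.LatticeModels.IsNondegenerateTwoPoint S → Literature.Probability.LatticeModels.HasNontrivialU4 S

-- earlier KirchhoffTorus (stmt-CriticalPhenomena-7083, replaced 2026-08-15T16:53:47Z -> stmt-CriticalPhenomena-11241): retired by None — ∀ (N : ℕ) (x y u : Literature.Probability.LatticeModels.Site 3), 2 ≤ N → Literature.Probability.LatticeModels.Torus.proj (N+1) x ≠ Literature.Probability.LatticeModels.Torus.proj (N+1) y → ∑ i : Fin 3, ((((Fintype.card (Equiv.Perm ↥(Literature.Probability.LatticeMo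
/-- item stmt-CriticalPhenomena-11241 · support · rank 9 · open · by planner
sources: LyonsPeres2016 §2.2–2.4 and §4.2, Tetali1991, Literature.Probability.LatticeModels.effectiveResistance_comm, Literature.Probability.LatticeModels.KirchhoffEdgeFormula_holds, Literature.Probability.LatticeModels.criticalBeta_pos_holds, Literature.Probability.LatticeModels.summable_currentWeight_indicator_holds
[support] (K) exact conservation at every finite volume, validating the inlined rev-2 definition:
for N ≥ 2 and proj x ≠ proj y, Σ_i [J_N(x,y;u,i) − J_N(x,y;u−e_i,i)] = 1[proj u = proj x] − 1[proj u
= proj y]. Proof sketch: (i) parity — proj x, proj y are the only odd vertices of η(n), hence in one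
component; (ii) unit-current theory on top of the tree's EffectiveResistance.lean (Dirichlet
principle, symmetry, Rayleigh, series bound, ℛ = ⊤ off the component, Kirchhoff's edge formula
proved — but no flows/potentials; ~250 lines): the Dirichlet infimum is attained, the minimiser is
harmonic off {v,w} and constant on other components, the grounded Green kernel is symmetric ⇒
Tetali's formula φ_z = (R_xy + R_zy − R_zx)/2 is the unit-flow potential ⇒ node law; antisymmetry
(effectiveResistance_comm), |θ_n| ≤ 1, θ_n = 0 on the diagonal and off the component
(effectiveResistance_of_not_disjoint, toReal ⊤ = 0; both checked in the Sketch); (iii) Σ_n P_N(n) =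
1 (currentSum > 0: criticalBeta_pos_holds + the path current) and
summable_currentWeight_indicator_holds to exchange E with Σ_i; N+1 ≥ 3 makes the six neighbours
proj(u ± e_i) distinct. The resistance formula was checked in exact arithm -/
@[route_item "route-CriticalPhenomena-MeanCurrentCircleLaw", crux]
def KirchhoffTorus : Prop :=
  ∀ (N : ℕ) (x y u : Literature.Probability.LatticeModels.Site 3), 2 ≤ N → Literature.Probability.LatticeModels.Torus.proj (N+1) x ≠ Literature.Probability.LatticeModels.Torus.proj (N+1) y → (let JN : Literature.Probability.LatticeModels.Site 3 → Fin 3 → ℝ := fun w i => (∑' n : Literature.Probability.LatticeModels.Current (Literature.Probability.LatticeModels.torusGraph 3 (N+1)), (if n.sources = symmDiff {Literature.Probability.LatticeModels.Torus.proj (N+1) x} {Literature.Probability.LatticeModels.Torus.proj (N+1) y} then n.weight (Literature.Probability.LatticeModels.criticalBeta 3) else 0) * (let c : Sym2 (Literature.Probability.LatticeModels.TorusSite 3 (N+1)) → NNReal := fun e => if h : e ∈ (Literature.Probability.LatticeModels.torusGraph 3 (N+1)).edgeFinset then (if Odd (n ⟨e, h⟩) then 1 else 0) else 0; let R : Literature.Probability.LatticeModels.TorusSite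 3 (N+1) → Literature.Probability.LatticeModels.TorusSite 3 (N+1) → ℝ := fun v w => (Literature.Probability.LatticeModels.effectiveResistance (Literature.Probability.LatticeModels.torusGraph 3 (N+1)) c {v} {w}).toReal; (c s(Literature.Probability.LatticeModels.Torus.proj (N+1) w, Literature.Probability.LatticeModels.Torus.proj (N+1) (w + Pi.single i 1)) : ℝ) * ((R (Literature.Probability.LatticeModels.Torus.proj (N+1) w) (Literature.Probability.LatticeModels.Torus.proj (N+1) y) - R (Literature.Probability.LatticeModels.Torus.proj (N+1) w) (Literature.Probability.LatticeModels.Torus.proj (N+1) x)) - (R (Literature.Probability.LatticeModels.Torus.proj (N+1) (w + Pi.single i 1)) (Literature.Probability.LatticeModels.Torus.proj (N+1) y) - R (Literature.Probability.LatticeModels.Torus.proj (N+1) (w + Pi.single i 1)) (Literature.Probability.LatticeModels.Torus.proj (N+1) x))) / 2)) / Literature.Probability.LatticeModels.currentSum (Literature.Probability.LatticeModels.torusGraph 3 (N+1)) (Literature.Probability.LatticeModels.criticalBeta 3) (symmDiff {Literature.Probability.LatticeModels.Torus.proj (N+1) x} {Literature.Probability.LatticeModels.Torus.proj (N+1) y});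 ∑ i : Fin 3, (JN u i - JN (u - Pi.single i 1) i)) = (if Literature.Probability.LatticeModels.Torus.proj (N+1) u = Literature.Probability.LatticeModels.Torus.proj (N+1) x then (1:ℝ) else 0) - (if Literature.Probability.LatticeModels.Torus.proj (N+1) u = Literature.Probability.LatticeModels.Torus.proj (N+1) y then (1:ℝ) else 0)

-- earlier GaussianWronskianRung (stmt-CriticalPhenomena-7085, replaced 2026-08-15T16:53:47Z -> stmt-CriticalPhenomena-11242): retired by None — Literature.Barriers.CriticalPhenomena.SpreadOutIsing.LiuSlade2026_nnGreenAsymptotics → ∀ (x y : EuclideanSpace ℝ (Fin 3)), x ≠ y → ∀ (φ : EuclideanSpace ℝ (Fin 3) → EuclideanSpace ℝ (Fin 3)), ContDiff ℝ ((⊤ : ℕ∞) : WithTop ℕ∞) φ → HasCompactSupport φ → x ∉ t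
/-- item stmt-CriticalPhenomena-11242 · support · rank 9 · open · by planner
sources: LawlerLimic2010 Thm 4.3.1 and Thm 6.3.8, Lawler1991 Thm 1.5.4, LyonsPeres2016 §2.2 and §4.2, doi:10.5948/upo9781614440222, FernandezFrohlichSokal1992 ch. 5, Literature.Barriers.CriticalPhenomena.SpreadOutIsing.LiuSlade2026_nnGreenAsymptotics_holds
[support] (W) the Gaussian rung where the law is TRUE: with g = latticeGreen (= G_RW/3 ~ 1/(2π|z|)),
the discrete Wronskian J_RW(u,i) = (g(u−x)g(y−u−e_i) − g(u+e_i−x)g(y−u))/(2g(y−x)) (= mean signed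
current of the simple-random-walk x→y path measure) paired at mesh δ with any smooth compactly
supported φ off {x,y} converges to ∫⟨B^{xy},φ⟩. Rev 2: the Green asymptotics |g(z) − 1/(2π|z|)| ≤
K/|z|³ are an INLINE elementary hypothesis (no barrier-file constant in the route); it is discharged
verbatim by the in-tree theorem LiuSlade2026_nnGreenAsymptotics_holds at d = 3 (gaussianAmp 3 =
3/(2π); jnorm = euclidNorm off 0) for whoever wants the unconditional corollary — import that Proofs
module in the Theorems file only. The hypothesis controls bond differences to relative O(δ); the
rest is Riemann sums. [difficulty: M] -/
@[route_item "route-CriticalPhenomena-MeanCurrentCircleLaw", crux]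
def GaussianWronskianRung : Prop :=
  (∃ K : ℝ, ∀ z : Literature.Probability.LatticeModels.Site 3, z ≠ 0 → |Literature.Probability.LatticeModels.latticeGreen z - 1 / (2 * Real.pi * Real.sqrt (∑ j : Fin 3, ((z j : ℤ) : ℝ) ^ 2))| ≤ K / (Real.sqrt (∑ j : Fin 3, ((z j : ℤ) : ℝ) ^ 2)) ^ 3) → ∀ (x y : EuclideanSpace ℝ (Fin 3)), x ≠ y → ∀ (φ : EuclideanSpace ℝ (Fin 3) → EuclideanSpace ℝ (Fin 3)), ContDiff ℝ ((⊤ : ℕ∞) : WithTop ℕ∞) φ → HasCompactSupport φ → x ∉ tsupport φ → y ∉ tsupport φ → Filter.Tendsto (fun δ : ℝ => ∑' u : Literature.Probability.LatticeModels.Site 3, ∑ i : Fin 3, δ * (φ (δ • ((EuclideanSpace.equiv (Fin 3) ℝ).symm (fun j => ((u j : ℤ) : ℝ))))) i * ((Literature.Probability.LatticeModels.latticeGreen (u - (Literature.Probability.LatticeModels.latticeApprox δ x)) * Literature.Probability.LatticeModels.latticeGreen ((Literature.Probability.LatticeModels.latticeApprox δ y) - (u + Pi.single i 1)) - Literature.Probability.LatticeModels.latticeGreen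 ((u + Pi.single i 1) - (Literature.Probability.LatticeModels.latticeApprox δ x)) * Literature.Probability.LatticeModels.latticeGreen ((Literature.Probability.LatticeModels.latticeApprox δ y) - u)) / (2 * Literature.Probability.LatticeModels.latticeGreen ((Literature.Probability.LatticeModels.latticeApprox δ y) - (Literature.Probability.LatticeModels.latticeApprox δ x))))) (nhdsWithin (0:ℝ) (Set.Ioi 0)) (nhds (∫ z, inner ℝ ((‖x - y‖ / (4 * Real.pi * ‖z - x‖ * ‖z - y‖)) • ((‖z - x‖ ^ 2)⁻¹ • (z - x) - (‖z - y‖ ^ 2)⁻¹ • (z - y))) (φ z)))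

/-- item stmt-CriticalPhenomena-7084 · support · rank 9 · open · by planner
sources: Beardon1983 §3, OsbornPetkou1994 §2, DiFrancescoMathieuSenechal1997 §4.1, BenedettiPetronio1992 ch. A
[support] (U) rigidity: if V : ℝ³ → ℝ³ is continuous off {x,y}, locally integrable, has weak
divergence δ_x − δ_y (∫⟨V,∇f⟩ = f(y) − f(x) for smooth compactly supported f) and is invariant as a
vector density under the inversion in every sphere through x and y (V(φz) =
(|z−c|⁴/r⁴)·Refl_((z−c)^⊥)(V z)), then V = B^(xy) off {x,y}. Proof: conjugate x↦0, y↦∞; the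
inversions become reflections in a.e. plane through 0, generating O(3); an O(3)-equivariant
continuous field is f(|w|)ŵ, divergence-free forces f = c/|w|², unit flux c = 1/4π; pull back (B is
checked invariant). Pure Mathlib analysis; the glue in "conformal currents ⇒ CircleLaw".
[difficulty: provable-now] -/
@[route_item "route-CriticalPhenomena-MeanCurrentCircleLaw", crux]
def BipolarUniqueness : Prop :=
  ∀ (x y : EuclideanSpace ℝ (Fin 3)), x ≠ y → ∀ (V : EuclideanSpace ℝ (Fin 3) → EuclideanSpace ℝ (Fin 3)), ContinuousOn V {x, y}ᶜ → MeasureTheory.LocallyIntegrable V MeasureTheory.volume → (∀ f : EuclideanSpace ℝ (Fin 3) → ℝ, ContDiff ℝ ((⊤ : ℕ∞) : WithTop ℕ∞) f → HasCompactSupport f → ∫ z, inner ℝ (V z) (gradient f z) = f y - f x) → (∀ (c : EuclideanSpace ℝ (Fin 3)) (r : ℝ), 0 < r → dist x c = r → dist y c = r → ∀ z : EuclideanSpace ℝ (Fin 3), z ≠ c → z ≠ x → z ≠ y → V (EuclideanGeometry.inversion c r z) = ((dist z c) ^ 4 / r ^ 4) • ((ℝ ∙ (z - c))ᗮ).reflection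 (V z)) → ∀ z : EuclideanSpace ℝ (Fin 3), z ≠ x → z ≠ y → V z = ((‖x - y‖ / (4 * Real.pi * ‖z - x‖ * ‖z - y‖)) • ((‖z - x‖ ^ 2)⁻¹ • (z - x) - (‖z - y‖ ^ 2)⁻¹ • (z - y)))

/-- item stmt-CriticalPhenomena-7086 · assembly · rank 1 · open · by planner
sources: Summits/CriticalPhenomena/Ising3DConformalLimit/Ideas/mean-current-circle-law.md, DuminilCopinICM2022 §8.4
[assembly] CircleLaw → HalfFluxLaw → MeanCurrentExists → MoebiusLimitExists →
IsingEuclidUpgradeR4NonGaussian → Ising3DConformalLimit. -/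
@[route_item "route-CriticalPhenomena-MeanCurrentCircleLaw", crux]
def Assembly : Prop :=
  Summit.CriticalPhenomena.Ising3DConformalLimit.Theses.MeanCurrentCircleLaw.CircleLaw → Summit.CriticalPhenomena.Ising3DConformalLimit.Theses.MeanCurrentCircleLaw.HalfFluxLaw → Summit.CriticalPhenomena.Ising3DConformalLimit.Theses.MeanCurrentCircleLaw.MeanCurrentExists → Summit.CriticalPhenomena.Ising3DConformalLimit.Theses.MeanCurrentCircleLaw.MoebiusLimitExists → Summit.CriticalPhenomena.Ising3DConformalLimit.Theses.MeanCurrentCircleLaw.IsingEuclidUpgradeR4NonGaussian → Ising3DConformalLimit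

/-! D-0027 §2.1 — DECIDING THEOREM (planner-authored via `route open/edit --closes-file`; by planner-rrepair-CriticalPhenomena-MeanCurrentC-799e5623-g2-0 2026-08-15T16:53:47Z):
its hypotheses are this route's items and its conclusion the sub-problem Statement (glue_lint), and it elaborates with this file. -/

@[closes "route-CriticalPhenomena-MeanCurrentCircleLaw"] theorem closes : CircleLaw → HalfFluxLaw → MeanCurrentExists → MoebiusLimitExists → IsingEuclidUpgradeR4NonGaussian → KirchhoffTorus → BipolarUniqueness → GaussianWronskianRung → Assembly → _root_.Ising3DConformalLimit := fun h_CircleLaw h_HalfFluxLaw h_MeanCurrentExists h_MoebiusLimitExists h_IsingEuclidUpgradeR4NonGaussian _h_KirchhoffTorus _h_BipolarUniqueness _h_GaussianWronskianRung h_Assembly => h_Assembly h_CircleLaw h_HalfFluxLaw h_MeanCurrentExists h_MoebiusLimitExists h_IsingEuclidUpgradeR4NonGaussian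

end Summit.CriticalPhenomena.Ising3DConformalLimit.Theses.MeanCurrentCircleLaw
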